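import Summits.QuantumAdvantage.QuantumAdvantage.Theorems.RankDialG2
import Literature.Computability.MetaComplexity.TwoModuliExpSums
import HarnessLib

/-!
# RankDial (H1) — §18 Viola–Wigderson with a different unit phase per coordinate, §19 characters of `ℤ/p`, the phases `ω·e_p(μ_i)` and the expansion of the wide affine tests

TARGET BY NAME (cell decomp-qadv, RESIDUAL MODE): item stmt-QuantumAdvantage-23109
`Summit.QuantumAdvantage.QuantumAdvantage.Theses.OddPrimeWalk.ManyReadersSqrtOdd`, through rung R5 = `AdviceFreeQNC0.WalkHardFLinSel p`.
This file SUPPORTS the item (`--supports`); it does not close it.  Declaration bodies are byte-identical to the cell node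
«MixedDial» (decomp-qadv lens-1, generation 26, part H; node file RankDialH.lean, whose §1–§17 are node «DegreeDial» =
parts G1–G2), cut into ≤ 400-line parts
H1 (§18 Viola–Wigderson with per-coordinate phases, §19 characters / phases / wide-test expansion) → H2 (§20 mixed fibre and window theorems) → H3 (§21 pieces `WindowMixedLinSel` PROVED `p ≠ 3`, residual `WindowCrowdLinSel`, `mixed_dial`);
see the node file for the mechanism summary.
-/

set_option linter.dupNamespace false
set_option autoImplicit false

noncomputable section
open Classical

namespace Summit.QuantumAdvantage.QuantumAdvantage.Theorems.RankDial

open Finset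
open Summit.QuantumAdvantage.AdviceFreeQNC0
open Literature.Computability.MetaComplexity Literature.Computability.MetaComplexity.Smolensky

/-! ## PART H «MixedDial» (g26): Viola–Wigderson with per-coordinate phases, the character expansion of the wide
affine tests, and the MIXED LAW — any number of narrow readers plus `k` wide readers with `(k+2)·M ≤ ℓ`. -/

/-! ### §18 Viola–Wigderson with a different unit phase on every coordinate (the tree's generality) -/

section VWProd
variable {ℓ : ℕ}

/-- **VW Lemma 2.3 + Fact 2.7 + the one-bit norm, PER-COORDINATE PHASES**: for `P : 𝔽₂^ℓ → 𝔽₂` of derivative-degree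
`≤ d` and unit phases `ζ_i`, `‖2^{-ℓ} Σ_z (−1)^{P z} Π_i (1,ζ_i)(z_i)‖^{2^{d+1}} ≤ Π_i (1 − (1 − Re ζ_i^{2^d})/2^{d+1})`.
[tree: `GowersCube.norm_avg_mul_signChar_pow_le`, `gowersU_pi`, `gowersU_succ_phaseFn`; ViolaWigderson2008 Thm 2.9] -/
theorem vw_prod_pow_le {d : ℕ} {P : (Fin ℓ → ZMod 2) → ZMod 2} (hP : GowersCube.DegLE d P)
    (ζ : Fin ℓ → ℂ) (hζ : ∀ i, ‖ζ i‖ = 1) :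
    ‖(∑ z : Fin ℓ → ZMod 2, GowersCube.signChar (P z) * ∏ i, GowersCube.phaseFn (ζ i) (z i)) / 2 ^ ℓ‖ ^ 2 ^ (d + 1) ≤
      ∏ i, (1 - (1 - ((ζ i) ^ 2 ^ d).re) / 2 ^ (d + 1)) := by
  have hmain := GowersCube.norm_avg_mul_signChar_pow_le d
    (fun z : Fin ℓ → ZMod 2 => ∏ i, GowersCube.phaseFn (ζ i) (z i)) P hP
  have havg : GowersCube.avg (fun z : Fin ℓ → ZMod 2 => (∏ i, GowersCube.phaseFn (ζ i) (z i)) *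
      GowersCube.signChar (P z)) =
      (∑ z : Fin ℓ → ZMod 2, GowersCube.signChar (P z) * ∏ i, GowersCube.phaseFn (ζ i) (z i)) / 2 ^ ℓ := by
    rw [GowersCube.avg, Fintype.card_fun, ZMod.card, Fintype.card_fin]
    push_cast
    congr 1
    exact Finset.sum_congr rfl fun z _ => mul_comm _ _
  have hpi : GowersCube.gowersU (d + 1) (fun z : Fin ℓ → ZMod 2 => ∏ i, GowersCube.phaseFn (ζ i) (z i)) =
      ∏ i, GowersCube.gowersU (d + 1) (GowersCube.phaseFn (ζ i)) :=
    GowersCube.gowersU_pi (d + 1) (fun i => GowersCube.phaseFn (ζ i))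
  have hprod : (∏ i, GowersCube.gowersU (d + 1) (GowersCube.phaseFn (ζ i))) =
      ((∏ i, (1 - (1 - ((ζ i) ^ 2 ^ d).re) / 2 ^ (d + 1)) : ℝ) : ℂ) := by
    rw [Complex.ofReal_prod]
    exact Finset.prod_congr rfl fun i _ => GowersCube.gowersU_succ_phaseFn d (ζ i) (hζ i)
  rw [havg, hpi, hprod, Complex.ofReal_re] at hmain
  exact hmain

/-- **Uniform decay**: if every `Re ζ_i^{2^d} ≤ 1 − η` (`0 ≤ η ≤ 2`) then
`‖Σ_z (−1)^{P z} Π_i (1,ζ_i)(z_i)‖ ≤ 2^ℓ·exp(−η ℓ/4^{d+1})`. -/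
theorem vw_prod_norm_le {d : ℕ} {P : (Fin ℓ → ZMod 2) → ZMod 2} (hP : GowersCube.DegLE d P)
    (ζ : Fin ℓ → ℂ) (hζ : ∀ i, ‖ζ i‖ = 1) {η : ℝ} (hη2 : η ≤ 2)
    (hη : ∀ i, ((ζ i) ^ 2 ^ d).re ≤ 1 - η) :
    ‖∑ z : Fin ℓ → ZMod 2, GowersCube.signChar (P z) * ∏ i, GowersCube.phaseFn (ζ i) (z i)‖ ≤
      2 ^ ℓ * Real.exp (-(η * ℓ / 4 ^ (d + 1))) := by
  set S := ∑ z : Fin ℓ → ZMod 2, GowersCube.signChar (P z) * ∏ i, GowersCube.phaseFn (ζ i) (z i) with hS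
  set A := ‖S / 2 ^ ℓ‖ with hA
  have h := vw_prod_pow_le hP ζ hζ
  have hN : (0 : ℝ) < 2 ^ (d + 1) := by positivity
  have h2N : (2 : ℝ) ≤ 2 ^ (d + 1) := by
    calc (2 : ℝ) = 2 ^ 1 := by norm_num
      _ ≤ 2 ^ (d + 1) := pow_le_pow_right₀ (by norm_num) (by omega)
  have hfac : ∀ i, 1 - (1 - ((ζ i) ^ 2 ^ d).re) / 2 ^ (d + 1) ≤ 1 - η / 2 ^ (d + 1) := by
    intro i
    have h1 : η / 2 ^ (d + 1) ≤ (1 - ((ζ i) ^ 2 ^ d).re) / 2 ^ (d + 1) :=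
      div_le_div_of_nonneg_right (by linarith [hη i]) hN.le
    linarith
  have hfac0 : ∀ i, 0 ≤ 1 - (1 - ((ζ i) ^ 2 ^ d).re) / 2 ^ (d + 1) := by
    intro i
    have hre : -1 ≤ ((ζ i) ^ 2 ^ d).re := by
      have := (abs_le.1 (Complex.abs_re_le_norm ((ζ i) ^ 2 ^ d))).1
      rw [norm_pow, hζ i, one_pow] at this
      exact this
    rw [sub_nonneg, div_le_one hN]
    linarith
  have hbase0 : 0 ≤ 1 - η / 2 ^ (d + 1) := by
    rw [sub_nonneg, div_le_one hN]
    linarith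
  have hbase : 1 - η / 2 ^ (d + 1) ≤ Real.exp (-(η / 2 ^ (d + 1))) := by
    have := Real.add_one_le_exp (-(η / 2 ^ (d + 1)))
    linarith
  have hprod : ∏ i, (1 - (1 - ((ζ i) ^ 2 ^ d).re) / 2 ^ (d + 1)) ≤ (1 - η / 2 ^ (d + 1)) ^ ℓ := by
    calc ∏ i, (1 - (1 - ((ζ i) ^ 2 ^ d).re) / 2 ^ (d + 1))
        ≤ ∏ _i : Fin ℓ, (1 - η / 2 ^ (d + 1)) := Finset.prod_le_prod (fun i _ => hfac0 i) (fun i _ => hfac i)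
      _ = (1 - η / 2 ^ (d + 1)) ^ ℓ := by rw [Finset.prod_const, Finset.card_univ, Fintype.card_fin]
  have h2 : A ^ 2 ^ (d + 1) ≤ Real.exp (-(η * ℓ / 4 ^ (d + 1))) ^ 2 ^ (d + 1) := by
    calc A ^ 2 ^ (d + 1) ≤ (1 - η / 2 ^ (d + 1)) ^ ℓ := le_trans h hprod
      _ ≤ Real.exp (-(η / 2 ^ (d + 1))) ^ ℓ := pow_le_pow_left₀ hbase0 hbase ℓ
      _ = Real.exp (-(η * ℓ / 4 ^ (d + 1))) ^ 2 ^ (d + 1) := by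
          rw [← Real.exp_nat_mul, ← Real.exp_nat_mul]
          congr 1
          have h4 : (4 : ℝ) ^ (d + 1) = 2 ^ (d + 1) * 2 ^ (d + 1) := by
            rw [← mul_pow]; norm_num
          rw [h4]
          field_simp
          push_cast
          ring
  have hAle : A ≤ Real.exp (-(η * ℓ / 4 ^ (d + 1))) :=
    (pow_le_pow_iff_left₀ (norm_nonneg _) (Real.exp_nonneg _) (pow_ne_zero _ two_ne_zero)).1 h2
  have hSA : ‖S‖ = 2 ^ ℓ * A := by
    rw [hA, norm_div, norm_pow, Complex.norm_ofNat]
    field_simp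
  rw [hSA]
  exact mul_le_mul_of_nonneg_left hAle (by positivity)

/-- **On the tree's cube `{0,1}^ℓ`** with the multilinear degree filtration: for `Q ∈ lowDeg 𝔽₂ ℓ d` and unit phases with
`Re ζ_i^{2^d} ≤ 1 − η`: `‖Σ_v (−1)^{Q v} Π_{i : v_i} ζ_i‖ ≤ 2^ℓ·exp(−η ℓ/4^{d+1})`. -/
theorem vw_prod_norm_le_cube {d : ℕ} {Q : CubeFn (ZMod 2) ℓ} (hQ : Q ∈ lowDeg (ZMod 2) ℓ d)
    (ζ : Fin ℓ → ℂ) (hζ : ∀ i, ‖ζ i‖ = 1) {η : ℝ} (hη2 : η ≤ 2)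
    (hη : ∀ i, ((ζ i) ^ 2 ^ d).re ≤ 1 - η) :
    ‖∑ v : Fin ℓ → Bool, GowersCube.signChar (Q v) * ∏ i, (if v i = true then ζ i else 1)‖ ≤
      2 ^ ℓ * Real.exp (-(η * ℓ / 4 ^ (d + 1))) := by
  have h := vw_prod_norm_le (GowersCube.degLE_of_mem_lowDeg hQ) ζ hζ hη2 hη
  have hsum : (∑ v : Fin ℓ → Bool, GowersCube.signChar (Q v) * ∏ i, (if v i = true then ζ i else 1)) =
      ∑ z : Fin ℓ → ZMod 2, GowersCube.signChar (Q (GowersCube.cubeOf z)) *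
        ∏ i, GowersCube.phaseFn (ζ i) (z i) := by
    refine Fintype.sum_equiv GowersCube.cubeEquiv _ _ fun v => ?_
    have hv : GowersCube.cubeOf (GowersCube.cubeEquiv v) = v := GowersCube.cubeEquiv.left_inv v
    rw [hv]
    congr 1
    refine Finset.prod_congr rfl fun i _ => ?_
    cases h : v i <;> simp [GowersCube.cubeEquiv, GowersCube.bit, GowersCube.phaseFn, h]
  rw [hsum]
  exact h

end VWProd

/-! ### §19 Characters of `ℤ/p`, the phases `ω·e_p(μ_i)`, and the expansion of the wide affine tests -/

section CharInd
variable {p : ℕ} [Fact p.Prime] {ℓ : ℕ}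

/-- The window linear form `Σ_{j : v_j} μ_j` of a coefficient vector `μ ∈ (ℤ/p)^ℓ`. -/
def linPart (μ : Fin ℓ → ZMod p) (v : Fin ℓ → Bool) : ZMod p := ∑ j, if v j then μ j else 0

/-- `k·lin(λ) + lin(μ) = lin(μ + k•λ)`. -/
theorem linPart_add_smul (μ lam : Fin ℓ → ZMod p) (k : ZMod p) (v : Fin ℓ → Bool) :
    k * linPart lam v + linPart μ v = linPart (μ + k • lam) v := by
  unfold linPart
  rw [Finset.mul_sum, ← Finset.sum_add_distrib]
  refine Finset.sum_congr rfl fun j _ => ?_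
  simp only [Pi.add_apply, Pi.smul_apply, smul_eq_mul]
  split_ifs <;> ring

/-- `e_p(k·lin λ)·e_p(lin μ) = e_p(lin(μ + kλ))`. -/
theorem stdAddChar_linPart_mul (μ lam : Fin ℓ → ZMod p) (k : ZMod p) (v : Fin ℓ → Bool) :
    (ZMod.stdAddChar (k * linPart lam v) : ℂ) * ZMod.stdAddChar (linPart μ v) =
      ZMod.stdAddChar (linPart (μ + k • lam) v) := by
  rw [← AddChar.map_add_eq_mul, linPart_add_smul]

/-- The `±1` SIGN of the affine `𝔽_p`-test `[lin λ (v) = ρ]`: `−1` if it fires, `+1` if not. -/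
def hypSgn (lam : Fin ℓ → ZMod p) (ρ : ZMod p) (v : Fin ℓ → Bool) : ℂ := if linPart lam v = ρ then -1 else 1

/-- `‖hypSgn‖ = 1`. -/
theorem norm_hypSgn (lam : Fin ℓ → ZMod p) (ρ : ZMod p) (v : Fin ℓ → Bool) : ‖hypSgn lam ρ v‖ = 1 := by
  unfold hypSgn; split_ifs <;> simp

/-- **Character expansion of one wide test**: `sgn = 1 − 2·p⁻¹·Σ_k e_p(−kρ) e_p(k·lin λ)`.
[tree: `TwoModuli.ite_eq_eq_sum_stdAddChar_one`] -/
theorem hypSgn_eq (lam : Fin ℓ → ZMod p) (ρ : ZMod p) (v : Fin ℓ → Bool) :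
    hypSgn lam ρ v = 1 - 2 * (((p : ℂ))⁻¹ * ∑ k : ZMod p,
      (ZMod.stdAddChar (-(k * ρ)) : ℂ) * ZMod.stdAddChar (k * linPart lam v)) := by
  rw [← TwoModuli.ite_eq_eq_sum_stdAddChar_one (linPart lam v) ρ]
  unfold hypSgn
  by_cases h : linPart lam v = ρ <;> norm_num [h]

/-- **THE EXPANSION LEMMA** (induction over the wide tests): if the test weight `T` has all its `e_p`-twisted sums
bounded by `A`, then multiplying `T` by the signs of `k` affine `𝔽_p`-tests costs at most a factor `3^k`
(each sign is `1` minus `2/p` times `p` characters). -/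
theorem norm_sum_mul_prod_hypSgn_le (T : (Fin ℓ → Bool) → ℂ) {A : ℝ}
    (hA : ∀ μ : Fin ℓ → ZMod p, ‖∑ v, T v * ZMod.stdAddChar (linPart μ v)‖ ≤ A)
    {κ : Type*} (W : Finset κ) (lamv : κ → Fin ℓ → ZMod p) (rho : κ → ZMod p) :
    ∀ μ : Fin ℓ → ZMod p,
      ‖∑ v, T v * (∏ g ∈ W, hypSgn (lamv g) (rho g) v) * ZMod.stdAddChar (linPart μ v)‖ ≤ 3 ^ W.card * A := by
  induction W using Finset.induction_on with
  | empty =>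
    intro μ
    simp only [Finset.prod_empty, mul_one, Finset.card_empty, pow_zero, one_mul]
    exact hA μ
  | @insert g₀ W hg₀ ih =>
    intro μ
    have hp0 : (p : ℂ) ≠ 0 := by exact_mod_cast (Fact.out : p.Prime).ne_zero
    -- expand the new sign
    have hv : ∀ v : Fin ℓ → Bool,
        T v * (∏ g ∈ insert g₀ W, hypSgn (lamv g) (rho g) v) * ZMod.stdAddChar (linPart μ v) =
          T v * (∏ g ∈ W, hypSgn (lamv g) (rho g) v) * ZMod.stdAddChar (linPart μ v) -
          2 * ((p : ℂ))⁻¹ * ∑ k : ZMod p, (ZMod.stdAddChar (-(k * rho g₀)) : ℂ) *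
            (T v * (∏ g ∈ W, hypSgn (lamv g) (rho g) v) * ZMod.stdAddChar (linPart (μ + k • lamv g₀) v)) := by
      intro v
      rw [Finset.prod_insert hg₀, hypSgn_eq]
      set PW := ∏ g ∈ W, hypSgn (lamv g) (rho g) v
      set S := ∑ k : ZMod p, (ZMod.stdAddChar (-(k * rho g₀)) : ℂ) * ZMod.stdAddChar (k * linPart (lamv g₀) v)
      have h1 : T v * ((1 - 2 * (((p : ℂ))⁻¹ * S)) * PW) * ZMod.stdAddChar (linPart μ v) =
          T v * PW * ZMod.stdAddChar (linPart μ v) -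
            2 * ((p : ℂ))⁻¹ * (S * (T v * PW * ZMod.stdAddChar (linPart μ v))) := by ring
      rw [h1, Finset.sum_mul]
      congr 2
      refine Finset.sum_congr rfl fun k _ => ?_
      rw [← stdAddChar_linPart_mul μ (lamv g₀) k v]
      ring
    rw [Finset.sum_congr rfl fun v _ => hv v, Finset.sum_sub_distrib, ← Finset.mul_sum, Finset.sum_comm]
    simp_rw [← Finset.mul_sum]
    have hcard : (insert g₀ W).card = W.card + 1 := Finset.card_insert_of_notMem hg₀
    rw [hcard, pow_succ]
    have hApos : 0 ≤ A := le_trans (norm_nonneg _) (hA 0)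
    calc ‖(∑ v, T v * (∏ g ∈ W, hypSgn (lamv g) (rho g) v) * ZMod.stdAddChar (linPart μ v)) -
          2 * ((p : ℂ))⁻¹ * ∑ k : ZMod p, (ZMod.stdAddChar (-(k * rho g₀)) : ℂ) *
            ∑ v, T v * (∏ g ∈ W, hypSgn (lamv g) (rho g) v) * ZMod.stdAddChar (linPart (μ + k • lamv g₀) v)‖
        ≤ ‖∑ v, T v * (∏ g ∈ W, hypSgn (lamv g) (rho g) v) * ZMod.stdAddChar (linPart μ v)‖ +
          ‖2 * ((p : ℂ))⁻¹ * ∑ k : ZMod p, (ZMod.stdAddChar (-(k * rho g₀)) : ℂ) *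
            ∑ v, T v * (∏ g ∈ W, hypSgn (lamv g) (rho g) v) * ZMod.stdAddChar (linPart (μ + k • lamv g₀) v)‖ :=
          norm_sub_le _ _
      _ ≤ 3 ^ W.card * A + 2 * (p : ℝ)⁻¹ * ∑ _k : ZMod p, 3 ^ W.card * A := by
          refine add_le_add (ih μ) ?_
          rw [norm_mul, norm_mul, Complex.norm_ofNat, norm_inv, Complex.norm_natCast]
          refine mul_le_mul_of_nonneg_left ?_ (by positivity)
          refine le_trans (norm_sum_le _ _) (Finset.sum_le_sum fun k _ => ?_)
          rw [norm_mul, AddChar.norm_apply, one_mul]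
          exact ih (μ + k • lamv g₀)
      _ = 3 ^ W.card * 3 * A := by
          rw [Finset.sum_const, Finset.card_univ, ZMod.card, nsmul_eq_mul]
          have hp0' : (p : ℝ) ≠ 0 := by exact_mod_cast (Fact.out : p.Prime).ne_zero
          field_simp
          ring

/-! #### The phases `ω·e_p(μ_i)` never resonate (`p ≠ 3`) -/

/-- The non-resonance margin `η_p = 2 sin²(π/(3p)) > 0`. -/
def etaP (p : ℕ) : ℝ := 2 * Real.sin (Real.pi / (3 * p)) ^ 2

/-- `0 < η_p`. -/
theorem etaP_pos : 0 < etaP p := by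
  have hp1 : (1 : ℝ) ≤ p := by exact_mod_cast (Fact.out : p.Prime).one_lt.le
  have hx0 : 0 < Real.pi / (3 * p) := by positivity
  have hxπ : Real.pi / (3 * p) < Real.pi := by
    rw [div_lt_iff₀ (by positivity)]
    nlinarith [Real.pi_pos]
  have hs := Real.sin_pos_of_pos_of_lt_pi hx0 hxπ
  unfold etaP
  positivity

omit [Fact p.Prime] in
/-- `η_p ≤ 2`. -/
theorem etaP_le_two (p : ℕ) : etaP p ≤ 2 := by
  unfold etaP
  nlinarith [Real.sin_sq_le_one (Real.pi / (3 * p)), Real.sin_sq_add_cos_sq (Real.pi / (3 * p)),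
    sq_nonneg (Real.cos (Real.pi / (3 * p)))]

/-- For a unit complex number `u`, `Re u = ‖1 + u‖²/2 − 1`. -/
theorem re_eq_norm_one_add_sq (u : ℂ) (hu : ‖u‖ = 1) : u.re = ‖1 + u‖ ^ 2 / 2 - 1 := by
  have hsq : u.re ^ 2 + u.im ^ 2 = 1 := by
    have := Complex.sq_norm u
    rw [hu, Complex.normSq_apply] at this
    nlinarith [this]
  rw [Complex.sq_norm, Complex.normSq_apply]
  simp only [Complex.add_re, Complex.one_re, Complex.add_im, Complex.one_im, zero_add]
  nlinarith [hsq]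

omit [Fact p.Prime] in
/-- **Non-resonance** [tree `TwoModuli.norm_one_add_exp_le`, Bourgain (10)]: for `3p ∤ K`,
`Re e^{2πiK/(3p)} ≤ 1 − η_p`. -/
theorem re_exp_le_of_not_dvd {K : ℕ} (hK : ¬ 3 * p ∣ K) :
    (Complex.exp (2 * Real.pi * Complex.I * K / (3 * p : ℕ))).re ≤ 1 - etaP p := by
  have hu : ‖Complex.exp (2 * Real.pi * Complex.I * K / (3 * p : ℕ))‖ = 1 := by
    rw [show (2 * Real.pi * Complex.I * K / (3 * p : ℕ) : ℂ) = ((2 * Real.pi * K / (3 * p : ℕ) : ℝ) : ℂ) * Complex.I by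
      push_cast; ring]
    exact Complex.norm_exp_ofReal_mul_I _
  have h := TwoModuli.norm_one_add_exp_le hK
  have h0 : 0 ≤ ‖(1 : ℂ) + Complex.exp (2 * Real.pi * Complex.I * K / (3 * p : ℕ))‖ := norm_nonneg _
  have hcos : ‖(1 : ℂ) + Complex.exp (2 * Real.pi * Complex.I * K / (3 * p : ℕ))‖ ^ 2 ≤
      (2 * Real.cos (Real.pi / (3 * p : ℕ))) ^ 2 := by
    have hc0 : 0 ≤ 2 * Real.cos (Real.pi / (3 * p : ℕ)) := le_trans h0 h
    exact pow_le_pow_left₀ h0 h 2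
  rw [re_eq_norm_one_add_sq _ hu]
  unfold etaP
  have hcs := Real.sin_sq_add_cos_sq (Real.pi / (3 * p))
  push_cast at hcos ⊢
  nlinarith [hcos, hcs]

/-- The phase of coordinate `i`: `ζ_i = ω·e_p(μ_i)`. -/
def zetaMu (μ : Fin ℓ → ZMod p) (i : Fin ℓ) : ℂ := omega3 * ZMod.stdAddChar (μ i)

/-- `‖ζ_i‖ = 1`. -/
theorem norm_zetaMu (μ : Fin ℓ → ZMod p) (i : Fin ℓ) : ‖zetaMu μ i‖ = 1 := by
  rw [zetaMu, norm_mul, norm_omega3, AddChar.norm_apply, one_mul]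

/-- `ζ_i = e^{2πi(p + 3·μ_i)/(3p)}`. -/
theorem zetaMu_eq_exp (μ : Fin ℓ → ZMod p) (i : Fin ℓ) :
    zetaMu μ i = Complex.exp (2 * Real.pi * Complex.I * ((p + 3 * (μ i).val : ℕ) : ℂ) / (3 * p : ℕ)) := by
  have hp0 : (p : ℂ) ≠ 0 := by exact_mod_cast (Fact.out : p.Prime).ne_zero
  rw [zetaMu, omega3, ← TwoModuli.exp_val_eq_stdAddChar (μ i), ← Complex.exp_add]
  congr 1
  push_cast
  field_simp

/-- **`Re ζ_i^{2^d} ≤ 1 − η_p` for `p ≠ 3`** (the power is `e^{2πiK/(3p)}` with `K = 2^d(p + 3μ_i) ≢ 0 (mod 3)`). -/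
theorem re_zetaMu_pow_le (hp3 : p ≠ 3) (μ : Fin ℓ → ZMod p) (i : Fin ℓ) (d : ℕ) :
    ((zetaMu μ i) ^ 2 ^ d).re ≤ 1 - etaP p := by
  have hpp : p.Prime := Fact.out
  have hK : ¬ 3 * p ∣ 2 ^ d * (p + 3 * (μ i).val) := by
    intro h
    have h3 : 3 ∣ 2 ^ d * (p + 3 * (μ i).val) := dvd_trans (Dvd.intro p rfl) h
    rcases (Nat.Prime.dvd_mul Nat.prime_three).1 h3 with h2 | h2
    · have := Nat.Prime.dvd_of_dvd_pow Nat.prime_three h2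
      omega
    · have hp' : 3 ∣ p := (Nat.dvd_add_left (Dvd.intro _ rfl)).1 h2
      exact hp3 ((Nat.prime_dvd_prime_iff_eq Nat.prime_three hpp).1 hp').symm
  have hpow : (zetaMu μ i) ^ 2 ^ d =
      Complex.exp (2 * Real.pi * Complex.I * ((2 ^ d * (p + 3 * (μ i).val) : ℕ) : ℂ) / (3 * p : ℕ)) := by
    rw [zetaMu_eq_exp, ← Complex.exp_nat_mul]
    congr 1
    push_cast
    ring
  rw [hpow]
  exact re_exp_le_of_not_dvd hK

/-- `ω^{|v|}·e_p(lin μ (v)) = Π_{i : v_i} ζ_i`. -/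
theorem omega3_pow_mul_stdAddChar_linPart (μ : Fin ℓ → ZMod p) (v : Fin ℓ → Bool) :
    omega3 ^ wt v * ZMod.stdAddChar (linPart μ v) = ∏ i, (if v i = true then zetaMu μ i else 1) := by
  rw [show omega3 ^ wt v = ∏ i, (if v i = true then omega3 else 1) from omega3_pow_wt v, linPart,
    TwoModuli.stdAddChar_sum_ite, ← Finset.prod_mul_distrib]
  refine Finset.prod_congr rfl fun i _ => ?_
  unfold zetaMu
  split_ifs <;> simp

/-- **The twisted VW bound for the narrow part**: for `Q ∈ lowDeg 𝔽₂ ℓ s`, every `μ ∈ (ℤ/p)^ℓ` and `p ≠ 3`,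
`‖Σ_v (−1)^{Q v} ω^{|v|} e_p(Σ_{j:v_j} μ_j)‖ ≤ 2^ℓ·exp(−η_p ℓ/4^{s+1})`. -/
theorem norm_twisted_narrow_le (hp3 : p ≠ 3) {s : ℕ} {Q : CubeFn (ZMod 2) ℓ} (hQ : Q ∈ lowDeg (ZMod 2) ℓ s)
    (μ : Fin ℓ → ZMod p) :
    ‖∑ v : Fin ℓ → Bool, GowersCube.signChar (Q v) * omega3 ^ wt v * ZMod.stdAddChar (linPart μ v)‖ ≤
      2 ^ ℓ * Real.exp (-(etaP p * ℓ / 4 ^ (s + 1))) := by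
  have h := vw_prod_norm_le_cube hQ (zetaMu μ) (norm_zetaMu μ) (etaP_le_two p)
    (fun i => re_zetaMu_pow_le hp3 μ i s)
  have hsum : (∑ v : Fin ℓ → Bool, GowersCube.signChar (Q v) * omega3 ^ wt v * ZMod.stdAddChar (linPart μ v)) =
      ∑ v : Fin ℓ → Bool, GowersCube.signChar (Q v) * ∏ i, (if v i = true then zetaMu μ i else 1) := by
    refine Finset.sum_congr rfl fun v _ => ?_
    rw [mul_assoc, omega3_pow_mul_stdAddChar_linPart]
  rw [hsum]
  exact h

end CharInd

end Summit.QuantumAdvantage.QuantumAdvantage.Theorems.RankDial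

end
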